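import Literature.MathematicalPhysics.KineticTheory.KickMatchedHardSphereGasPieces
import HarnessLib

/-!
# The one-step mark identity of the kick-matched gas `Z*`: the resampled mark is admissible-flux distributed

Topic `Literature/MathematicalPhysics/KineticTheory`; companion of `KickMatchedHardSphereGasPieces` (the three-piece
split `defect = markPiece + shieldPiece + selectPiece`) and `KickMatchedCollisionSum` (crux
`stmt-AtomisticToContinuum-13914`, line `stein-lindeberg-kick-swap`, stub S1 `FairGasContactChaos`, piece M "mark
martingale"). The ONE-STEP identity behind piece M: at a collision of `Z*` resolving the incoming pair `(i, j)` of the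
pre-collisional configuration `y` with the die `d`, the post-collisional configuration is `kmRule σ N i j y d =
kickAt i j (kmNormal i j y d) y`, and

* the mark read on it is `(kmNormal i j y d, vᵢ, vⱼ)` — the resampled normal and the PRE-collisional velocities
  (`KickMatchedCollisionSum.markAt_of_eq_kickAt` with `norm_kmNormal`; entered here as the hypothesis `hmark`);
* `collidePair_kickAt`, `kickAt_congr`, `isAdmissible_congr`, `admFluxMean_congr`, `admFluxMean_collidePair_kmRule`:
  the "pre-collisional configuration recovered by `collidePair`" from the post-collisional one differs from `y` only
  in the position of the re-placed partner `j`, on which neither the admissible set nor the restricted flux mean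
  `admFluxMean` depend — so the centring term of `markPiece` at a `Z*` collision IS the restricted flux mean at `y`;
* `integral_dice_comp_kmNormal`, `integral_dice_markAt_eq_admFluxMean`: GIVEN ITS INPUT `y`, the die-average of any
  measurable function of the resampled mark is its restricted (admissible) flux mean:
  `∫ Ψ(markAt(kmRule i j y d)) d(dice)(d) = admFluxMean σ N Ψ y i j`. The law of the resampled normal enters as the
  hypothesis `hlaw` (an identity of measures: `dice ∘ (kmNormal i j y)⁻¹ =` normalised `fluxLaw vᵢ vⱼ` restricted to
  the admissible set, pushed to `V3`), which is the rejection-sampling theorem `map_dice_kmNormal` of the companion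
  module `KickMatchedNormalLaw` (hat-box lemma `map_lift_volume_ball` + `KernelGas.map_dice_firstHit`); it holds
  whenever `vᵢ ≠ vⱼ` and the admissible set has positive flux measure.

Consequence (not formalised here): along `Z*`, conditional on the dice of the first `k` collisions, the `(k+1)`-st
increment `χ · (Ψ(mark) − admFluxMean) · P` of `markPiece` has mean zero for every weight `P` measurable with respect
to the past — the martingale-transform structure of piece M (S. Chatterjee, Ann. Probab. 34 (2006), the swap
bookkeeping [Chatterjee2006]; F. Comets et al., ARMA 191 (2008) §2.2, cosine-law reflections driven by i.i.d. draws
[CometsEtAl2008]). Every declaration is elementary, tagged `[folklore]`.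
-/

noncomputable section

open scoped BigOperators ENNReal Topology RealInnerProductSpace
open MeasureTheory Set Filter
open Literature.Analysis.FluidPDE

namespace Literature.MathematicalPhysics.KineticTheory

namespace KickMatchedHardSphereGas

variable {σ : ℝ} {N : ℕ}

/-! ## The recovered pre-collisional configuration: only the partner's position changes -/

/-- `collidePair` undoes the reflection of a kick: the configuration recovered from a kicked one is `y` with the
partner `j` re-placed at `xᵢ − ε ω` (same velocities). [folklore] -/
theorem collidePair_kickAt {i j : Fin (N + 1)} (hij : i ≠ j) (ω : V3) (y : Cfg N) :
    collidePair geo i j (kickAt σ N i j ω y) =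
      Function.update y j (geo.translate (y i).1 (-(hsDiameter σ N • ω)), (y j).2) := by
  unfold kickAt
  exact collidePair_collidePair hij _

/-- A kick depends on the configuration only off the partner `j` and through the partner's velocity. [folklore] -/
theorem kickAt_congr {i j : Fin (N + 1)} (hij : i ≠ j) {y y₂ : Cfg N} (h : ∀ k, k ≠ j → y₂ k = y k)
    (h2 : (y₂ j).2 = (y j).2) (ω : V3) : kickAt σ N i j ω y₂ = kickAt σ N i j ω y := by
  unfold kickAt
  congr 1
  funext k
  by_cases hk : k = j
  · subst hk
    rw [Function.update_self, Function.update_self, h i hij, h2]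
  · rw [Function.update_of_ne hk, Function.update_of_ne hk, h k hk]

/-- Admissibility depends on the configuration only off the partner `j` and through the partner's velocity.
[folklore] -/
theorem isAdmissible_congr {i j : Fin (N + 1)} (hij : i ≠ j) {y y₂ : Cfg N} (h : ∀ k, k ≠ j → y₂ k = y k)
    (h2 : (y₂ j).2 = (y j).2) (ω : V3) : IsAdmissible σ N i j ω y₂ ↔ IsAdmissible σ N i j ω y := by
  unfold IsAdmissible
  rw [kickAt_congr hij h h2, h i hij, h2]

/-- The restricted flux mean depends on the configuration only off the partner `j` and through the partner's
velocity. [folklore] -/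
theorem admFluxMean_congr {i j : Fin (N + 1)} (hij : i ≠ j) {y y₂ : Cfg N} (h : ∀ k, k ≠ j → y₂ k = y k)
    (h2 : (y₂ j).2 = (y j).2) (Ψ : V3 × V3 × V3 → ℝ) : admFluxMean σ N Ψ y₂ i j = admFluxMean σ N Ψ y i j := by
  have hA : ∀ ω : V3, IsAdmissible σ N i j ω y₂ ↔ IsAdmissible σ N i j ω y := isAdmissible_congr hij h h2
  unfold admFluxMean
  simp only [hA, h i hij, h2]

/-- **The centring term of `markPiece` at a `Z*` collision is the restricted flux mean at the pre-collisional
configuration**: `admFluxMean` at `collidePair i j (kickAt i j ω y)` equals `admFluxMean` at `y`. [folklore] -/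
theorem admFluxMean_collidePair_kickAt {i j : Fin (N + 1)} (hij : i ≠ j) (ω : V3) (y : Cfg N)
    (Ψ : V3 × V3 × V3 → ℝ) : admFluxMean σ N Ψ (collidePair geo i j (kickAt σ N i j ω y)) i j = admFluxMean σ N Ψ y i j := by
  rw [collidePair_kickAt hij]
  exact admFluxMean_congr hij (fun k hk => Function.update_of_ne hk _ _) (by rw [Function.update_self]) Ψ

/-- The same for the kick-matched rule `kmRule i j y d = kickAt i j (kmNormal i j y d) y`. [folklore] -/
theorem admFluxMean_collidePair_kmRule {i j : Fin (N + 1)} (hij : i ≠ j) (y : Cfg N) (d : Die)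
    (Ψ : V3 × V3 × V3 → ℝ) : admFluxMean σ N Ψ (collidePair geo i j (kmRule σ N i j y d)) i j = admFluxMean σ N Ψ y i j :=
  admFluxMean_collidePair_kickAt hij _ y Ψ

/-! ## Given its input, the resampled mark is admissible-flux distributed -/

/-- **Die-average of a function of the resampled normal = its restricted flux mean**, given the law identity `hlaw`
of the resampled normal (`map_dice_kmNormal` of `KickMatchedNormalLaw`): `∫ g(kmNormal i j y d) d(dice)(d) =
(fluxLaw A)⁻¹ ∫_A g d(fluxLaw vᵢ vⱼ)`, `A` the admissible set. [folklore] -/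
theorem integral_dice_comp_kmNormal {i j : Fin (N + 1)} {y : Cfg N} {μ : Measure Die}
    (hmeas : AEMeasurable (kmNormal σ N i j y) μ)
    (hlaw : μ.map (kmNormal σ N i j y) =
      ((fluxLaw (y i).2 (y j).2 {ω | IsAdmissible σ N i j (ω : V3) y})⁻¹ •
        (fluxLaw (y i).2 (y j).2).restrict {ω | IsAdmissible σ N i j (ω : V3) y}).map (↑))
    {g : V3 → ℝ} (hg : Measurable g) :
    ∫ d, g (kmNormal σ N i j y d) ∂μ =
      (fluxLaw (y i).2 (y j).2 {ω | IsAdmissible σ N i j (ω : V3) y}).toReal⁻¹ *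
        ∫ ω in {ω | IsAdmissible σ N i j (ω : V3) y}, g (ω : V3) ∂(fluxLaw (y i).2 (y j).2) := by
  rw [← integral_map hmeas hg.aestronglyMeasurable, hlaw,
    integral_map measurable_subtype_coe.aemeasurable hg.aestronglyMeasurable, integral_smul_measure,
    ENNReal.toReal_inv, smul_eq_mul]

/-- **Die-average of `Ψ` of the resampled mark = `admFluxMean σ N Ψ y i j`** (the restricted flux mean of
`Ψ(·, vᵢ, vⱼ)` over the admissible normals of `y`), given the law identity `hlaw`. [folklore] -/
theorem integral_dice_kmNormal_eq_admFluxMean {i j : Fin (N + 1)} {y : Cfg N} {μ : Measure Die}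
    (hmeas : AEMeasurable (kmNormal σ N i j y) μ)
    (hlaw : μ.map (kmNormal σ N i j y) =
      ((fluxLaw (y i).2 (y j).2 {ω | IsAdmissible σ N i j (ω : V3) y})⁻¹ •
        (fluxLaw (y i).2 (y j).2).restrict {ω | IsAdmissible σ N i j (ω : V3) y}).map (↑))
    {Ψ : V3 × V3 × V3 → ℝ} (hΨ : Measurable Ψ) :
    ∫ d, Ψ (kmNormal σ N i j y d, (y i).2, (y j).2) ∂μ = admFluxMean σ N Ψ y i j := by
  have hg : Measurable fun ω : V3 => Ψ (ω, (y i).2, (y j).2) := hΨ.comp (measurable_id.prodMk measurable_const)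
  have h := integral_dice_comp_kmNormal hmeas hlaw hg
  exact h

/-- **The one-step mark identity of `Z*`**: for any family of paths `γ d` whose mark at time `s d` reads
`(kmNormal i j y d, vᵢ, vⱼ)` (hypothesis `hmark`: by `KickMatchedCollisionSum.markAt_of_eq_kickAt` this is the case
when `γ d (s d)` is the post-collisional configuration `kmRule σ N i j y d` of a pair at distance `ε`), the
die-average of `Ψ` of the mark is the restricted flux mean: `∫ Ψ(markAt (γ d) (s d) i j) dμ(d) = admFluxMean σ N Ψ y
i j` — the resampled mark is admissible-flux distributed GIVEN ITS INPUT (law identity `hlaw` = `map_dice_kmNormal`).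
[folklore] -/
theorem integral_dice_markAt_eq_admFluxMean {i j : Fin (N + 1)} {y : Cfg N} {μ : Measure Die}
    (hmeas : AEMeasurable (kmNormal σ N i j y) μ)
    (hlaw : μ.map (kmNormal σ N i j y) =
      ((fluxLaw (y i).2 (y j).2 {ω | IsAdmissible σ N i j (ω : V3) y})⁻¹ •
        (fluxLaw (y i).2 (y j).2).restrict {ω | IsAdmissible σ N i j (ω : V3) y}).map (↑))
    {Ψ : V3 × V3 × V3 → ℝ} (hΨ : Measurable Ψ) {γ : Die → ℝ → Cfg N} {s : Die → ℝ}
    (hmark : ∀ d, markAt σ N (γ d) (s d) i j = (kmNormal σ N i j y d, (y i).2, (y j).2)) :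
    ∫ d, Ψ (markAt σ N (γ d) (s d) i j) ∂μ = admFluxMean σ N Ψ y i j := by
  simp only [hmark]
  exact integral_dice_kmNormal_eq_admFluxMean hmeas hlaw hΨ

/-- **The centred increment of `markPiece` at a `Z*` collision has die-mean zero**:
`∫ (Ψ(kmNormal i j y d, vᵢ, vⱼ) − admFluxMean σ N Ψ (collidePair i j (kmRule i j y d)) i j) dμ(d) = 0` for a
probability law `μ` of the die satisfying `hlaw`, `Ψ` measurable and bounded (the mark of the post-collisional
configuration IS `(kmNormal i j y d, vᵢ, vⱼ)` by `KickMatchedCollisionSum.markAt_of_eq_kickAt`) — the one-step content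
of the statement that `markPiece` along `Z*` is a sum of martingale differences. [folklore] -/
theorem integral_dice_kmNormal_sub_admFluxMean_eq_zero {i j : Fin (N + 1)} (hij : i ≠ j) {y : Cfg N}
    {μ : Measure Die} [IsProbabilityMeasure μ] (hmeas : AEMeasurable (kmNormal σ N i j y) μ)
    (hlaw : μ.map (kmNormal σ N i j y) =
      ((fluxLaw (y i).2 (y j).2 {ω | IsAdmissible σ N i j (ω : V3) y})⁻¹ •
        (fluxLaw (y i).2 (y j).2).restrict {ω | IsAdmissible σ N i j (ω : V3) y}).map (↑))
    {Ψ : V3 × V3 × V3 → ℝ} (hΨ : Measurable Ψ) {C : ℝ} (hC : ∀ p, |Ψ p| ≤ C) :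
    ∫ d, (Ψ (kmNormal σ N i j y d, (y i).2, (y j).2) -
      admFluxMean σ N Ψ (collidePair geo i j (kmRule σ N i j y d)) i j) ∂μ = 0 := by
  have hcen : ∀ d, admFluxMean σ N Ψ (collidePair geo i j (kmRule σ N i j y d)) i j = admFluxMean σ N Ψ y i j :=
    fun d => admFluxMean_collidePair_kmRule hij y d Ψ
  simp only [hcen]
  have hint : Integrable (fun d => Ψ (kmNormal σ N i j y d, (y i).2, (y j).2)) μ := by
    have hg : Measurable fun ω : V3 => Ψ (ω, (y i).2, (y j).2) := hΨ.comp (measurable_id.prodMk measurable_const)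
    refine Integrable.of_bound (C := C) (hg.comp_aemeasurable hmeas).aestronglyMeasurable
      (Filter.Eventually.of_forall fun d => ?_)
    rw [Real.norm_eq_abs]
    exact hC _
  rw [integral_sub hint (integrable_const _), integral_const, probReal_univ, one_smul,
    integral_dice_kmNormal_eq_admFluxMean hmeas hlaw hΨ, sub_self]

end KickMatchedHardSphereGas

end Literature.MathematicalPhysics.KineticTheory

end
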